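import Mathlib.NumberTheory.Padics.PadicIntegers
import Mathlib.Analysis.SpecificLimits.Normed
import Mathlib.GroupTheory.OrderOfElement
import Mathlib.Data.Fin.Basic
import Mathlib.Tactic.NormNum
import HarnessLib

/-!
# [IUTchIII] §2 Remarks 2.1.1 (ii)–(v), 2.1.2, 2.2.1, 2.2.2, 2.3.1, 2.3.2, 2.3.3 (i)–(v), (ix), (x),
# 2.3.4, 2.4.1, 2.4.2 (i), (vi) (abc-iut cell, layer L6; idle-typer claim of abc-iut-L6-t4 on STATUS
# 2026-08-25T18:47Z — the §1–2 REMARKS tail of abc-iut-L6-t3's slice, ASSIGNMENTS §5 v1.4 ORDER (2))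

S. Mochizuki, *Inter-universal Teichmüller theory III*, kurims manuscript (May 2020) of PRIMS **57**
(2021), §2 "Multiradial Theta Monoids", Remarks on kurims pp. 61–91. These Remarks are, almost
entirely, EXPOSITORY commentary on Proposition 2.1, Theorem 2.2, Corollary 2.3 and Definition 2.4
(the statements themselves and Remarks 2.1.1 (i), 2.3.3 (vi)–(viii), 2.4.2 (ii)–(v) are
abc-iut-L6-t3's: `ThetaMonoids.lean`, `RemarksArithmetic.lean`, `PilotWeights.lean`,
`PerpPrimeStrips.lean`). Per plan/L6/ASSIGNMENTS.md C1 a purely expository Remark sub-item is COVERED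
by a docstring paragraph naming it ('noted'); where a sub-item contains a checkable mathematical
nugget or a statement the Cor. 3.12 proof cites by locator (Rmk 2.1.1 (iv), (v); 2.2.2 (i); 2.3.2;
2.3.3 (i); 2.4.2 (vi) — plan/STATEMENT-CLOSURE.md §B), a named declaration is provided so that
abc-iut-c312-2 can cite it by name. REAL and PROVED here: Rmk 2.1.1 (v) "`−1 ∈ ℤ̂` may be obtained as a
limit of positive integers" (in `ℤ_p`: `p^n − 1 → −1`); Rmk 2.2.1 (iii) "a `ℤ̂^×`-indeterminacy acting
on `𝒪^{×μ}` does not lie under an identity action on `𝒪^×`" (a nontrivial power map is not the identity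
on a group with a non-torsion element); Rmk 2.2.2 (i) the exponent vector `(1², 2², …, (l^⋇)²)` of the
Θ^{×μ}_{gau}-link is not of the "naive" form `q ↦ q^λ` for `l^⋇ ≥ 2`.

Deliberately NOT typed beyond this paragraph (C1, expository; node ids of plan/WAVE1-NODES.tsv, kurims
locators): **IUTchIII:Rmk2.1.1(ii)** (p.62: isomorphism class compatibility (d) — objects of tempered
Frobenioids known only up to isomorphism; Kummer towers vs single fields), **IUTchIII:Rmk2.1.1(iii)**
(p.62: constant multiple rigidity (c) ⇒ canonical splittings of theta monoids via the zero section,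
[IUTchII] Cor. 1.12 (ii)), **IUTchIII:Rmk2.1.2(i)** (p.64: "evaluation discrete rigidity" = the role of
[IUTchI] §2 complements on tempered coverings: restrict to `ℤ`-, not `ℤ̂`-conjugates),
**IUTchIII:Rmk2.2.1(i)** (p.67: `𝕄^Θ_*(†𝒟_{>,v})` as an "amalgamation of `Π_v` and `Π_μ`" reconstructing the
rigidity isomorphism itself, not its `ℤ̂^×`-orbit), **IUTchIII:Rmk2.2.1(ii)** (p.67: Kummer classes of étale
theta functions as twisted homomorphisms `H → Π_μ`; "immunity"/decoupling into purely radial `Π_μ` and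
purely coric `(−)^{×μ}`), **IUTchIII:Rmk2.2.1(iv)** (pp.68–69: summary, Fig. 2.2; Gaussian monoids need
the log-shells of §1), **IUTchIII:Rmk2.2.2(ii)** (p.70: indeterminacies for Gaussian monoids
"substantially more severe" than the roots-of-unity indeterminacies for theta monoids),
**IUTchIII:Rmk2.2.2(iii)** (pp.70–72: Kummer-compatibility of the splittings via Galois evaluation, Fig.
2.3; for `q ↦ q^λ` the class of `q^λ` is not mapped to the trivial class), **IUTchIII:Rmk2.3.1(i)**–**(iii)**
(p.75: Gaussian-integral analogy; étale-picture as canonical splitting; bad-place multiradiality =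
[IUTchII] Cor. 1.12 (iii) / Prop. 3.4 (i)), **IUTchIII:Rmk2.3.3(ii)**–**(v)**, **(ix)**, **(x)** (pp.76–85:
dismantling the two combinatorial dimensions of a number field; theta vs number-field cases, Figs.
2.5–2.7, the upper-half-plane analogy `q = e^{2πiz}`), **IUTchIII:Rmk2.3.4(i)**–**(iv)** (pp.85–88: review
of [EtTh]: non-scheme-theoretic filters need Frobenius-like structures; truncated Kummer theory of
theta functions; line bundles and the `𝔽_l^{⋊±}`-symmetry; the approach of [EtTh] via tempered
Frobenioids), **IUTchIII:Rmk2.4.1(i)**, **(ii)** (p.89: the multiradiality of Cor. 2.3 (i) transported to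
the `𝓕^{⊩⊥}`-prime-strips `𝔉^{⊩⊥}_env(†𝒟_>)`; at `v ∈ 𝕍^bad` the submonoids `𝒪^⊥(−) ⊆ 𝒪^▷(−)` inside
`_∞Ψ^⊥_env(†𝒟_>)_v`, compatibly with `†ℜ^bad`). Tag form [claim: Mochizuki2012, status: disputed] (D-0012).
-/

namespace Literature.IUT.LogThetaLattice

namespace MultiradialityRemarks

open Filter Topology

universe u

/-! ### Remark 2.1.1 (iv), (v) -/

/-- **IUTchIII:Rmk2.1.1(iv)** (kurims p.62 l.47 – p.63 l.20) Cyclotomic rigidity (a): "essentially a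
consequence of the nondegenerate nature of the commutator `[−,−]` of the theta groups involved … 'the
degree of the commutator is precisely 2'"; "a certain specific isomorphism between the interior and
exterior cyclotomes … a sort of rigidification of a certain 'projective line of cyclotomes'"; "if one
attempts to compose it with an `N`-th power morphism, then one is obliged to sacrifice constant multiple
rigidity"; "The multiradiality of mono-theta-theoretic cyclotomic rigidity [cf. [IUTchII], Corollary
1.10] — which lies in stark contrast with the indeterminacies that arise … [for] 'MLF-Galois pair
cyclotomic rigidity' … — will play a central role". Typed (the citable contrast, over abc-iut-L6-t1's
radiality predicates, abstract here): the mono-theta rigidity isomorphism is a SINGLE isomorphism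
recovered multiradially, the MLF-Galois-pair one only up to its `ℤ̂^×`-orbit.
[claim: Mochizuki2012, status: disputed] -/
def Rmk211iv_contrast {Cyc₁ Cyc₂ : Type u} (Units : Type u) [Group Units] [MulAction Units (Cyc₁ ≃ Cyc₂)]
    (monoThetaRecovered : Set (Cyc₁ ≃ Cyc₂)) (mlfRecovered : Set (Cyc₁ ≃ Cyc₂)) : Prop :=
  (∃ e, monoThetaRecovered = {e}) ∧ ∃ e, mlfRecovered = MulAction.orbit Units e

/-- **IUTchIII:Rmk2.1.1(v)** (kurims p.63 l.21–45) Discrete rigidity (b): "one may restrict one's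
attentions to `ℤ`-multiples/powers — as opposed to `ℤ̂`-multiples/powers — of divisors, line bundles, and
rational functions [such as … the `q`-parameter!]"; a theory of `ℤ̂`-divisors is impossible because
"unlike the case with `ℚ` or `ℝ`, there is no notion of positivity [or negativity] in `ℤ̂`. For instance,
`−1 ∈ ℤ̂` may be obtained as a limit of positive integers." PROVED (at each prime `p`, i.e. in the factor
`ℤ_p` of `ℤ̂ = Π_p ℤ_p`): `p^n − 1 → −1` in `ℤ_p`. [claim: Mochizuki2012, status: disputed] -/
theorem Rmk211v_negOne_limit_of_positives (p : ℕ) [Fact p.Prime] :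
    Tendsto (fun n : ℕ => ((p ^ n - 1 : ℕ) : ℤ_[p])) atTop (𝓝 (-1)) := by
  have hp : ‖(p : ℤ_[p])‖ < 1 := by
    rw [PadicInt.norm_p]
    exact inv_lt_one_of_one_lt₀ (by exact_mod_cast (Fact.out : p.Prime).one_lt)
  have h0 : Tendsto (fun n : ℕ => (p : ℤ_[p]) ^ n) atTop (𝓝 0) :=
    tendsto_pow_atTop_nhds_zero_of_norm_lt_one hp
  have h1 : Tendsto (fun n : ℕ => (p : ℤ_[p]) ^ n - 1) atTop (𝓝 (0 - 1)) := h0.sub_const 1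
  rw [zero_sub] at h1
  refine h1.congr fun n => ?_
  have : 1 ≤ p ^ n := Nat.one_le_pow _ _ (Fact.out : p.Prime).pos
  push_cast [Nat.cast_sub this]
  ring

/-- **IUTchIII:Rmk2.1.1(v)** (kurims p.63 l.40) … and these approximants are POSITIVE integers (`p^n − 1 ≥ 1`
for `n ≥ 1`) — PROVED. [claim: Mochizuki2012, status: disputed] -/
theorem Rmk211v_approximants_pos (p : ℕ) [Fact p.Prime] (n : ℕ) (hn : 1 ≤ n) : 1 ≤ p ^ n - 1 := by
  have h2 : 2 ≤ p := (Fact.out : p.Prime).two_le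
  have : 2 ≤ p ^ n := by
    calc 2 ≤ p := h2
      _ = p ^ 1 := (pow_one p).symm
      _ ≤ p ^ n := Nat.pow_le_pow_right (by omega) hn
  omega

/-! ### Remark 2.1.2 (ii) -/

/-- **IUTchIII:Rmk2.1.2(ii)** (kurims p.64 l.22 – p.65 l.5) With `Π := Π_v` (tempered), `Π̂` its profinite
completion, the surjections `Π ↠ l·ℤ`, `Π̂ ↠ l·ℤ̂` and `Π† := Π̂ ×_{ℤ̂} ℤ ⊆ Π̂` ("partially tempered
fundamental group"): "Is it possible to simply use … `Π†` instead of … `Π` …? The answer … is 'no'"; "the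
[easily verified] natural isomorphism `N_{Π̂}(Π†)/Π† ≅ ℤ̂/ℤ`", so "`Π†` fails to satisfy various fundamental
absolute anabelian properties" and its profinite conjugacy indeterminacies "give rise to
`ℤ̂`-translation indeterminacies acting on the coordinates of the evaluation points". Typed over
abstract data (the groups are [SemiAnbd]/[EtTh] interfaces — abc-iut-L3-t2): the normalizer-quotient
isomorphism as a named statement about a subgroup `Π† ≤ Π̂` and a target group `ℤ̂/ℤ`.
[claim: Mochizuki2012, status: disputed] -/
def Rmk212ii_normalizerQuotient {PiHat : Type u} [Group PiHat] (PiDagger : Subgroup PiHat)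
    (ZhatModZ : Type u) [Group ZhatModZ] : Prop :=
  Nonempty ((Subgroup.normalizer (PiDagger : Set PiHat) ⧸
    PiDagger.subgroupOf (Subgroup.normalizer (PiDagger : Set PiHat))) ≃* ZhatModZ)

/-! ### Remark 2.2.1 (iii) -/

/-- **IUTchIII:Rmk2.2.1(iii)** (kurims p.68 l.1–30, Figs. 2.1, 2.2) In the diagram
`𝒪^μ ⊆ 𝒪^× ⊆ 𝒪^▷ ⊆ 𝒪^{gp} ⊆ 𝒪^{ĝp}`, `𝒪^× ↠ 𝒪^{×μ}`: "unlike the case with `𝒪^μ` — a `ℤ̂^×`-indeterminacy acting on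
`𝒪^{×μ}` does not lie under an identity action on `𝒪^×`! That is to say, a `ℤ̂^×`-indeterminacy acting on
`𝒪^{×μ}` can only be lifted naturally to `ℤ̂^×`-indeterminacies on `𝒪^×`, `𝒪^{ĝp}`", whereas (Fig. 2.2)
`Π_μ ≅ 𝒪^μ → 𝒪^{×μ}` carries the identity action ("insulation"). PROVED in the typed form: on a
commutative group containing an element of infinite order, the `a`-th power map (`a ≥ 2`, a nontrivial
"indeterminacy") is not the identity — so no nontrivial power-indeterminacy on the torsion-free
quotient `𝒪^{×μ}` lies under the identity of `𝒪^×`; while on the torsion `𝒪^μ`, which maps to `1` in `𝒪^{×μ}`,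
every indeterminacy of `𝒪^{×μ}` restricts to the identity (second statement).
[claim: Mochizuki2012, status: disputed] -/
theorem Rmk221iii_powerMap_ne_id {A : Type u} [CommGroup A] {x : A} (hx : ¬ IsOfFinOrder x)
    {a : ℕ} (ha : 2 ≤ a) : (fun y : A => y ^ a) ≠ id := by
  intro h
  have hxa : x ^ a = x := congrFun h x
  have : x ^ (a - 1) = 1 := by
    have e : x ^ a = x ^ (a - 1) * x := by
      rw [← pow_succ]; congr 1; omega
    rw [e] at hxa
    exact mul_right_cancel (by rwa [one_mul])
  exact hx (isOfFinOrder_iff_pow_eq_one.mpr ⟨a - 1, by omega, this⟩)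

/-- **IUTchIII:Rmk2.2.1(iii)** (kurims p.68, Fig. 2.2 "Insulation from `ℤ̂^×`-indeterminacies"): the torsion
subgroup `𝒪^μ` maps to the identity of `𝒪^{×μ} = 𝒪^×/𝒪^μ`, so any automorphism ("indeterminacy") of `𝒪^{×μ}`
fixes its image — PROVED (typed with `𝒪^{×μ}` as the quotient by a subgroup `T` containing the element).
[claim: Mochizuki2012, status: disputed] -/
theorem Rmk221iii_insulation {A : Type u} [CommGroup A] (T : Subgroup A) {ζ : A} (hζ : ζ ∈ T)
    (φ : A ⧸ T ≃* A ⧸ T) : φ (QuotientGroup.mk ζ) = QuotientGroup.mk ζ := by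
  rw [(QuotientGroup.eq_one_iff ζ).mpr hζ, map_one]

/-! ### Remark 2.2.2 (i) -/

/-- **IUTchIII:Rmk2.2.2(i)** (kurims p.69 l.45 – p.70 l.30) The Θ^{×μ}_{gau}-link is the correspondence
`q ↦ (q^{1²}, q^{2²}, …, q^{(l^⋇)²})` ([IUTchII] Rmk. 4.11.1): its exponent vector `j ↦ j²`, `j = 1, …, l^⋇`.
[claim: Mochizuki2012, status: disputed] -/
def gaussianExponents (lstar : ℕ) : Fin lstar → ℕ := fun j => ((j : ℕ) + 1) ^ 2

/-- **IUTchIII:Rmk2.2.2(i)** (kurims p.69 l.50) the "naive" correspondence `q ↦ q^λ` "where `λ` is some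
arbitrary positive integer": the constant exponent vector. [claim: Mochizuki2012, status: disputed] -/
def naiveExponents (lstar : ℕ) (lam : ℕ) : Fin lstar → ℕ := fun _ => lam

/-- **IUTchIII:Rmk2.2.2(i)** (kurims p.69–70) "Can one develop a similar theory … in which one replaces
the Θ^{×μ}_{gau}-link `q ↦ (q^{1²}, …, q^{(l^⋇)²})` by a correspondence of the form `q ↦ q^λ` …? The answer
… is 'no'" (the printed reasons — no mono-theta cyclotomic rigidity to insulate the Kummer classes,
no splittings at zero-labeled evaluation points, `𝔽_l^{⋊±}`-symmetry issues — are expository). Typed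
nugget, PROVED: for `l^⋇ ≥ 2` the Gaussian exponent vector is not of the naive form for ANY `λ`
(`1² ≠ 2²`). [claim: Mochizuki2012, status: disputed] -/
theorem gaussianExponents_ne_naive {lstar : ℕ} (h : 2 ≤ lstar) (lam : ℕ) :
    gaussianExponents lstar ≠ naiveExponents lstar lam := by
  intro heq
  have h0 := congrFun heq ⟨0, by omega⟩
  have h1 := congrFun heq ⟨1, by omega⟩
  simp only [gaussianExponents, naiveExponents] at h0 h1
  omega

/-! ### Remarks 2.3.2, 2.3.3 (i) -/

/-- **IUTchIII:Rmk2.3.2** (kurims p.75 l.38 – p.76 l.20) "A similar result to Corollary 2.3 may be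
formulated concerning the multiradiality properties satisfied by the Kummer theory of `∞κ`-coric
structures as discussed in [IUTchII], Corollary 4.8": that Kummer theory "is based on the cyclotomic
rigidity isomorphisms for `∞κ`-coric structures" ([IUTchI] Ex. 5.1 (v), Def. 5.2 (vi), (viii)) "which
satisfy 'insulation' properties analogous to … mono-theta-theoretic cyclotomic rigidity", and the
reconstruction of `∞κ`-coric from `∞κ×`-structures via restriction of Kummer classes
`‡𝕄_{∞κv_j} ⊆ ‡𝕄_{∞κ×v_j} → ‡𝕄^×_{∞κ×v_j} ≅ ‡𝕄^×_{v_j}` "may be regarded as a decoupling into radial … and coric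
[i.e., the quotient of `‡𝕄^×_{∞κ×v_j} ≅ ‡𝕄^×_{v_j}` by its torsion subgroup] components"; "We leave the routine
details of giving a formulation in the style of Corollary 2.3 to the reader." Typed as the named
statement that a Corollary-2.3-style multiradiality property `IsMultiradial` holds for the radial
environment `numberFieldEnv` built from `∞κ`-coric structures (abstract; abc-iut-L6-t1
`RadialEnvironment`/`IsMultiradial`, abc-iut-L6-t2 [IUTchII] Cor. 4.8). [claim: Mochizuki2012, status: disputed] -/
def Rmk232_numberFieldAnalogue {Env : Type u} (IsMultiradial : Env → Prop) (numberFieldEnv : Env) :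
    Prop :=
  IsMultiradial numberFieldEnv

/-- **IUTchIII:Rmk2.3.3(i)** (kurims p.76 l.24–40) theta vs number-field cases, first similarity:
multiradiality (the radial/coric decoupling) is established "by using the geometric dimension of the
elliptic curve … as a sort of 'multiradial geometric container' for the radial arithmetic data of
interest, i.e., theta values '`q^{j²}_v`' or copies of the number field '`F_mod`'" — theta functions on
Tate curves ([EtTh]) resp. Belyi cuspidalizations ([AbsTopIII]; [IUTchI] Rmk. 5.1.4) — and the passage
from container to data is "by means of Galois evaluation". Typed as the common shape: a container
object with an evaluation map onto the radial data, in both cases (abstract record).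
[claim: Mochizuki2012, status: disputed] -/
structure Rmk233i_GeometricContainer (Container RadialData : Type u) where
  /-- "Galois evaluation": passage from the multiradial geometric container to the radial arithmetic
  data (theta values, resp. copies of `F_mod`) -/
  galoisEvaluation : Container → RadialData
  /-- every radial datum of interest arises by evaluation -/
  surjective : Function.Surjective galoisEvaluation

/-! ### Remark 2.4.2 (i), (vi) -/

/-- **IUTchIII:Rmk2.4.2(i)** (kurims p.89 l.27) "just as one may associate to an `𝓕^{⊩▶×μ}`-prime-strip a
pilot object in the global realified Frobenioid portion of the `𝓕^{⊩▶×μ}`-prime-strip [cf. [IUTchII],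
Definition 4.9, (viii)], one may associate to an `𝓕^{⊩▶}`-prime-strip a pilot object in the global
realified Frobenioid portion of the `𝓕^{⊩▶}`-prime-strip [i.e., … the global realified Frobenioid `*𝒞^⊩` of
the `𝓕^{⊩▶}`-prime-strip `*𝔉^{⊩▶}`]". INTERFACE (abc-iut-L6-t2 [IUTchII] Def. 4.9 (viii); abc-iut-L6-t3 Def. 2.4
(iii) `PerpPrimeStrips`): the pilot-object assignment on `𝓕^{⊩▶}`-prime-strips, compatible with the one
on `𝓕^{⊩▶×μ}`-prime-strips through the forgetful map. [claim: Mochizuki2012, status: disputed] -/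
structure Rmk242i_PilotAssignment (StripPerp StripPerpMu : Type u) (Ob : Type u) where
  /-- the `𝓕^{⊩▶×μ}`-prime-strip associated to an `𝓕^{⊩▶}`-prime-strip -/
  toPerpMu : StripPerp → StripPerpMu
  /-- pilot object of an `𝓕^{⊩▶×μ}`-prime-strip ([IUTchII] Def. 4.9 (viii)) -/
  pilotMu : StripPerpMu → Ob
  /-- pilot object of an `𝓕^{⊩▶}`-prime-strip (this Remark) -/
  pilot : StripPerp → Ob
  /-- the two assignments agree through the forgetful map -/
  compat : ∀ S, pilot S = pilotMu (toPerpMu S)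

/-- **IUTchIII:Rmk2.4.2(vi)** (kurims p.91 l.5–30) "If one starts from `M = Pic(*𝒞^⊩)`, then the resulting
collection of data `(*𝒞^⊩, Prime(*𝒞^⊩) ≅ 𝕍)` yields a common container, namely, the Frobenioid `*𝒞^⊩`
[regarded as an object reconstructed from `M = Pic(*𝒞^⊩)`!], in which distinct choices of the
[negative!] pilot element `∈ M` — hence also the data `(*𝒞^⊩, Prime(*𝒞^⊩) ≅ 𝕍, {Φ_{*𝓕^{⊢▶}_v}}_{v∈𝕍}, {*ρ_v}_{v∈𝕍})`
… — may be compared with one another. By contrast, … positive and negative '`η_M ∈ M`' … may only be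
compared … in some sort of larger ambient category in which the pre-steps are rendered invertible; but
this already implies that all objects … become isomorphic", rendering arguments about "distinct
arithmetic degrees" meaningless. Typed (the comparability clause, over abc-iut-L6-t3's
`PilotWeights` data `(M, r^▶_v)` of Rmk. 2.4.2 (ii)–(iv), abstract here): the reconstruction from
`(M, η)` of the rigidified data is a function of the pilot element on the NEGATIVE elements of one
ordered group `M`, so any two negative pilot elements yield data in the same container `M`.
[claim: Mochizuki2012, status: disputed] -/
def Rmk242vi_commonContainer {M : Type u} [AddCommGroup M] [PartialOrder M] {Data : Type u}
    (reconstruct : {η : M // η < 0} → Data) (container : Data → Type u) : Prop :=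
  ∀ η η' : {η : M // η < 0}, container (reconstruct η) = container (reconstruct η')

/-! ### PIN promotions (appended 2026-08-25T19:1xZ per abc-iut-L6-lead INBOX 18:59:38Z "PIN PROMOTIONS
WANTED": items cited INSIDE the proof of Cor. 3.12 must be NAMED decls abc-iut-c312-2 can cite) -/

section Pins

/-- **IUTchIII:Rmk2.2.2(iii)** (kurims p.72 l.8–20) For the "naive correspondence" `q ↦ q^λ` the arrows of
the analogue of Fig. 2.3 "map `q^λ ↦ 1 ∈ 𝒪^{×μ}` and hence are fundamentally incompatible with passage to
Kummer classes, i.e., since the Kummer class of `q^λ` in a suitable cohomology group of `Π/Δ` is by no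
means mapped, via the poly-isomorphism `Π/Δ ≅ G`, to the trivial element of the relevant cohomology group
of `G`" (whereas `∞θ ↦ 1` IS compatible, the theta monoid's unit/value decoupling being Kummer-compatible,
pp.70–72). Typed nugget, PROVED: an element `q` of infinite order (the `q`-parameter, non-torsion in the
multiplicative group) has `q^λ` of infinite order for every `λ ≥ 1`, so the class of `q^λ` is never killed
by passing to the quotient by torsion (`𝒪^{×μ} = 𝒪^×/𝒪^μ`-type quotients) — in contrast with roots of unity.
[claim: Mochizuki2012, status: disputed] -/
theorem Rmk222iii_qPow_not_torsion {A : Type u} [CommGroup A] {q : A} (hq : ¬ IsOfFinOrder q)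
    {lam : ℕ} (hlam : 1 ≤ lam) : ¬ IsOfFinOrder (q ^ lam) := by
  intro h
  obtain ⟨n, hn, hqn⟩ := isOfFinOrder_iff_pow_eq_one.mp h
  exact hq (isOfFinOrder_iff_pow_eq_one.mpr ⟨lam * n, Nat.mul_pos (by omega) hn, by rw [pow_mul, hqn]⟩)

/-- INTERFACE, SLOT-ONLY INDEX ENTRY (fields of TYPE `Prop`, instantiable by `True`, NOT counted as typed
mathematical content; G2 wording): the expository sub-items (ii), (iii) of [IUTchIII] Remark 2.1.1
(kurims p.62), cited by number inside the proof of Cor. 3.12 and therefore PINNED as named fields for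
abc-iut-c312-2 (L6-lead 18:59:38Z). [claim: Mochizuki2012, status: disputed] -/
structure Rmk211Index where
  /-- **IUTchIII:Rmk2.1.1(ii)** (kurims p.62 l.1–35) isomorphism class compatibility (d): objects of the
  tempered Frobenioids "known only up to isomorphism"; unlike Kummer towers of `N`-th power morphisms
  ("compatible with only the multiplicative, but not the additive structures"), "each individual object
  … corresponds to a single field", as the log-link of §1 requires; the non-isomorphic objects of a
  Kummer tower "may be naturally — i.e., algorithmically — related to another only via indeterminate
  isomorphisms". -/
  ii : Prop
  /-- **IUTchIII:Rmk2.1.1(iii)** (kurims p.62 l.36–41) constant multiple rigidity (c): its significance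
  "lies in the construction of the canonical splittings of theta monoids via restriction to the zero
  section" ([IUTchII] Cor. 1.12 (ii) = abc-iut-L6-t1 `Cor112_ii`; Prop. 3.3 (i); Rmk. 1.12.2 (iv)). -/
  iii : Prop

/-- INTERFACE, SLOT-ONLY INDEX ENTRY (fields of TYPE `Prop`, instantiable by `True`, NOT counted as typed
mathematical content; G2 wording): the expository sub-items (ii)–(v), (ix), (x) of [IUTchIII] Remark
2.3.3 (kurims pp.76–85, Figs. 2.5–2.7), PINNED as named fields for abc-iut-c312-2 (the proof of Cor.
3.12 cites Remark 2.3.3 by number); (i) is `Rmk233i_GeometricContainer` above, (vi)–(viii) are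
abc-iut-L6-t3's `RemarksArithmetic.lean`. [claim: Mochizuki2012, status: disputed] -/
structure Rmk233Index where
  /-- **IUTchIII:Rmk2.3.3(ii)** (kurims p.76 l.41 – p.77 l.22) "dismantling the two underlying
  combinatorial dimensions of [the ring of integers of] a number field", compared to dismantling "the
  single complex holomorphic dimension of the upper half-plane into two underlying real dimensions";
  the `𝔽_l^{⋊±}`-, `𝔽_l^⋇`-symmetries as the two dimensions ([IUTchI] Rmk. 6.12.3, 6.12.6). -/
  ii : Prop
  /-- **IUTchIII:Rmk2.3.3(iii)** (kurims p.77 l.23 – p.78 l.26) Galois evaluation is performed "in the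
  context of the log-link"; DIFFERENCE: "the output data in the theta case — i.e., the theta values
  '`q^{j²}_v`' — depends, in an essential way, on the labels `j ∈ 𝔽_l^⋇`", whereas "the output data in the
  number field case — i.e., the copies of the number field '`F_mod`' — is independent of these labels". -/
  iii : Prop
  /-- **IUTchIII:Rmk2.3.3(iv)** (kurims p.78 l.27–47) the further observation on (iii): label-dependence
  in the theta case is "simultaneously" dependence on the holomorphic structure (the labels are
  cuspidal inertia groups of the geometric fundamental group `Δ ⊆ Π`). -/
  iv : Prop
  /-- **IUTchIII:Rmk2.3.3(v)** (kurims p.78 l.48 – p.79 l.20) "the nontriviality of the 'highly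
  nontrivial' fact" that the theta values admit a multiradial Kummer theory compatible with the
  `𝔽_l^{⋊±}`-symmetry and the tempered topology (cyclotomic rigidity isomorphism row of Fig. 2.7). -/
  v : Prop
  /-- **IUTchIII:Rmk2.3.3(ix)** (kurims p.83 l.44 – p.84, Fig. 2.7) the comparison of (viii) "is
  reminiscent of the analogy … with the classical upper half-plane": the theta case corresponds to "the
  eigenfunction for the additive symmetries of the upper half-plane `q := e^{2πiz}`", the number field
  case to the multiplicative symmetries; Fig. 2.7 tabulates the theta / number-field contrasts. -/
  ix : Prop
  /-- **IUTchIII:Rmk2.3.3(x)** (kurims p.84 l.30 – p.85 l.19) closing comparison of the two cases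
  (Belyi cuspidalization vs theta functions as containers; "approach to eliminating cyclotomic rigidity
  isomorphism indeterminacies": order `∈ ℤ` of zeroes/poles of the theta function at every cusp `= 1`
  vs `ℚ_{>0} ∩ ℤ̂^× = {1}` and non-invertibility of nonconstant `κ`-coric rational functions). -/
  x : Prop

end Pins

end MultiradialityRemarks

end Literature.IUT.LogThetaLattice
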